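import Literature.NumberTheory.Automorphic.IrreducibleClassesConstituents
import Literature.NumberTheory.Automorphic.UnitaryGroupCohomologicalForms
import Literature.NumberTheory.Automorphic.UnitaryGroupPlaceInclusion
import Literature.NumberTheory.Automorphic.AdelicUnitaryGroupDatum
import HarnessLib

/-!
# Local constituents of a discrete automorphic representation EXIST at every finite place (the (J2) witness)

Crux H413 (`stmt-HodgeConjecture-24833`), rung 3 ∕ S-layer, F0P3-plan (g3) ruling (R1) (2026-08-31): the AUTOMORPHIC-SIDE
non-vacuity witness for the finite clause D6 (b2) `LocalConstituentsIn` of the global A-packet vocabulary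
([Rogawski1990, §13.1 p. 199]: «the set of `π = ⊗ π_v` such that `π_v ∈ Π_v` for all `v`», read constituent-wise as
«every constituent class of `P|_{U(J)(F_v)}` lies in `Π(ξ_v)`»), in EXACTLY its currency:

* §1 for an irreducible smooth `σ` of `U(J)(𝔸_{F,f})` on `W : Type`, the restriction `σ ∘ inclPlace v` to the place-`v` factor
  `U(J)(F_v) = ↥(localPi E c N J v)` (★ `UnitaryGroup.inclPlace`) is smooth (★ `Representation.IsSmooth.comp`, ★
  `continuous_inclPlace`) on a non-trivial space, hence HAS a constituent (★ `IrrClass.exists_isConstituentOf`);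
* §2 if `σ` OCCURS in `P` (★ `DiscreteAutomorphicRep.HasFinComponent P σ`: an injective `U(J)(𝔸_{F,f})`-map `σ → P.finRep`), every
  constituent of `σ ∘ inclPlace v` is a constituent of `P.finRep ∘ inclPlace v` (★ `IrrClass.IsConstituentOf.of_injective_comp`), so
  `P.finRep ∘ inclPlace v` HAS a constituent at EVERY finite place `v` (`exists_isConstituentOf_finRep_comp`) — also in the
  `IrrClass.comap (localPiEquiv … v) c` form over classes of `U(J)(F_v) = ↥(«local» E c N J v) = (adelicGroupData …).Local v`
  (★ P1 `IrrClass.comap`, ★ `localPiEquiv`) in which D6 (b2) quantifies, and in the CM frame over `(cmDatum L 3 H).Local v`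
  (the carrier of ★ `Rogawski1990.CMLocalAPacket L H v`);
* §3′∕§4 the same in the SMOOTH-PART currency (b2′) `P.finRep.smoothPart.toRepresentation ∘ inclPlace v` (p03 (g5) finding
  (F1)∕(F2), 05:28Z: an occurring smooth `σ` lands in ★ `Representation.smoothPart` by ★ `IsSmoothVector.map`);
* §3 the NON-VACUITY form: a hypothesis «every (comap-)constituent of `P.finRep ∘ inclPlace v` satisfies `Q`» produces a class
  satisfying `Q` — so `MemAPacket P ξ` forces `(Π(ξ_v)).members ∩ {constituents} ≠ ∅` at every finite `v` for any `P` with a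
  finite component, and S3♭∕T♭∕M♭ over D6 have content (REF1 (g3) pre-audit (J2), 2026-08-31T05:03:24Z ∕ 05:19:39Z).

Helper file (`--supports stmt-HodgeConjecture-24833 --as helper`); 0 def, 0 sorry; generic over the tree's unitary-group frame
`(F, E, c, N, J)`, CM corollaries at `(L⁺, L, c̄, 3, H)`.  NOT here: the TRANSFER of constituent classes `P′ → P` through a common
finite component (p03 (g5)'s T♭ core, ruling (N6)), anything archimedean.
HC_CM is proved only modulo the printed citations until rung 0 closes.
-/

set_option autoImplicit false
-- the mandated namespace repeats `HodgeConjecture.HodgeConjecture`, as in every `Theorems/*.lean` of this sub-problem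
set_option linter.dupNamespace false

noncomputable section

open MeasureTheory NumberField IsDedekindDomain
open Literature.NumberTheory.Automorphic Literature.NumberTheory.Automorphic.UnitaryGroup

namespace Summit.HodgeConjecture.HodgeConjecture.Cruxes.H413.F0P3FinRepConstituentsExist

/-! ## §1 Restriction of an irreducible smooth `σ` of `U(J)(𝔸_{F,f})` to the place-`v` factor -/

section Generic

variable {F E : Type} [Field F] [NumberField F] [Field E] [NumberField E] [Algebra F E] {c : E ≃ₐ[F] E} {N : ℕ}
  {J : Matrix (Fin N) (Fin N) E}

/-- `σ ∘ inclPlace v` is smooth for a smooth `σ` (★ `IsSmooth.comp`, ★ `continuous_inclPlace`). -/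
theorem isSmooth_comp_inclPlace {W : Type} [AddCommGroup W] [Module ℂ W] {σ : Representation ℂ (finAdelic F E c N J) W}
    (hsm : σ.IsSmooth) (v : HeightOneSpectrum (𝓞 F)) : Representation.IsSmooth (σ.comp (inclPlace F E c N J v)) :=
  hsm.comp _ (continuous_inclPlace F E c N J v)

/-- **`σ|_{U(J)(F_v)}` has a constituent** for every irreducible smooth `σ` of `U(J)(𝔸_{F,f})` on `W : Type` and every finite
place `v`. -/
theorem exists_isConstituentOf_comp_inclPlace {W : Type} [AddCommGroup W] [Module ℂ W]
    {σ : Representation ℂ (finAdelic F E c N J) W} (hirr : σ.IsIrreducible) (hsm : σ.IsSmooth)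
    (v : HeightOneSpectrum (𝓞 F)) :
    ∃ c₀ : IrrClass ↥(localPi E c N J v), c₀.IsConstituentOf (σ.comp (inclPlace F E c N J v)) := by
  haveI : Nontrivial W := IrrClass.nontrivial_of_isIrreducible σ
  exact IrrClass.exists_isConstituentOf _ (isSmooth_comp_inclPlace hsm v)

/-! ## §2 `P.finRep ∘ inclPlace v` has a constituent whenever `P` has a finite component -/

variable {μ : Measure (adelicGroupData F E c N J).automorphicQuotient}
  [SMulInvariantMeasure (adelicGroupData F E c N J).Adelic (adelicGroupData F E c N J).automorphicQuotient μ]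

/-- **Constituents of an occurring `σ` are constituents of `P`, place by place**: if `σ` occurs in `P` (★ `HasFinComponent`),
every constituent of `σ ∘ inclPlace v` is a constituent of `P.finRep ∘ inclPlace v`. -/
theorem isConstituentOf_finRep_comp_of_hasFinComponent (P : DiscreteAutomorphicRep (adelicGroupData F E c N J) μ)
    {W : Type} [AddCommGroup W] [Module ℂ W] {σ : Representation ℂ (finAdelic F E c N J) W} (hP : P.HasFinComponent σ)
    {v : HeightOneSpectrum (𝓞 F)} {c₀ : IrrClass ↥(localPi E c N J v)}
    (hc₀ : c₀.IsConstituentOf (σ.comp (inclPlace F E c N J v))) :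
    c₀.IsConstituentOf (P.finRep.comp (inclPlace F E c N J v)) := by
  obtain ⟨f, hf⟩ := hP
  exact hc₀.of_injective_comp _ f hf

/-- **`P.finRep ∘ inclPlace v` HAS a constituent at every finite place `v`** as soon as `P` has an irreducible smooth finite
component `σ` (on `W : Type`). -/
theorem exists_isConstituentOf_finRep_comp (P : DiscreteAutomorphicRep (adelicGroupData F E c N J) μ)
    {W : Type} [AddCommGroup W] [Module ℂ W] {σ : Representation ℂ (finAdelic F E c N J) W} (hirr : σ.IsIrreducible)
    (hsm : σ.IsSmooth) (hP : P.HasFinComponent σ) (v : HeightOneSpectrum (𝓞 F)) :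
    ∃ c₀ : IrrClass ↥(localPi E c N J v), c₀.IsConstituentOf (P.finRep.comp (inclPlace F E c N J v)) := by
  obtain ⟨c₀, hc₀⟩ := exists_isConstituentOf_comp_inclPlace hirr hsm v
  exact ⟨c₀, isConstituentOf_finRep_comp_of_hasFinComponent P hP hc₀⟩

/-- The same in the `comap` currency of D6 (b2): a class `c` of `U(J)(F_v) = ↥(«local» E c N J v)` (= `(adelicGroupData …).Local v`)
whose pull-back `IrrClass.comap (localPiEquiv … v) c` (★ P1) is a constituent of `P.finRep ∘ inclPlace v` EXISTS. -/
theorem exists_comap_isConstituentOf_finRep_comp (P : DiscreteAutomorphicRep (adelicGroupData F E c N J) μ)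
    {W : Type} [AddCommGroup W] [Module ℂ W] {σ : Representation ℂ (finAdelic F E c N J) W} (hirr : σ.IsIrreducible)
    (hsm : σ.IsSmooth) (hP : P.HasFinComponent σ) (v : HeightOneSpectrum (𝓞 F)) :
    ∃ c' : IrrClass ↥(«local» E c N J v),
      (IrrClass.comap (localPiEquiv E c N J v) c').IsConstituentOf (P.finRep.comp (inclPlace F E c N J v)) := by
  obtain ⟨c₀, hc₀⟩ := exists_isConstituentOf_finRep_comp P hirr hsm hP v
  exact ⟨IrrClass.comap (localPiEquiv E c N J v).symm c₀, by rwa [IrrClass.comap_comap_symm]⟩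

/-- Equivalently: the TRANSPORTED class `IrrClass.comap (localPiEquiv … v).symm c₀` of a constituent `c₀` of `σ ∘ inclPlace v` is, read
back through `localPiEquiv`, a constituent of `P.finRep ∘ inclPlace v` (the form in which a member of `Π(ξ_v)` is matched). -/
theorem comap_symm_isConstituentOf_finRep_comp (P : DiscreteAutomorphicRep (adelicGroupData F E c N J) μ)
    {W : Type} [AddCommGroup W] [Module ℂ W] {σ : Representation ℂ (finAdelic F E c N J) W} (hP : P.HasFinComponent σ)
    {v : HeightOneSpectrum (𝓞 F)} {c₀ : IrrClass ↥(localPi E c N J v)}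
    (hc₀ : c₀.IsConstituentOf (σ.comp (inclPlace F E c N J v))) :
    (IrrClass.comap (localPiEquiv E c N J v) (IrrClass.comap (localPiEquiv E c N J v).symm c₀)).IsConstituentOf
      (P.finRep.comp (inclPlace F E c N J v)) := by
  rw [IrrClass.comap_comap_symm]
  exact isConstituentOf_finRep_comp_of_hasFinComponent P hP hc₀

/-! ## §3 Non-vacuity of «every constituent of `P|_{U(J)(F_v)}` satisfies `Q`» -/

/-- **NON-VACUITY (plain currency)**: if every constituent of `P.finRep ∘ inclPlace v` satisfies `Q`, some class satisfies `Q`. -/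
theorem exists_isConstituentOf_finRep_comp_and (P : DiscreteAutomorphicRep (adelicGroupData F E c N J) μ)
    {W : Type} [AddCommGroup W] [Module ℂ W] {σ : Representation ℂ (finAdelic F E c N J) W} (hirr : σ.IsIrreducible)
    (hsm : σ.IsSmooth) (hP : P.HasFinComponent σ) (v : HeightOneSpectrum (𝓞 F)) {Q : IrrClass ↥(localPi E c N J v) → Prop}
    (hQ : ∀ c₀ : IrrClass ↥(localPi E c N J v), c₀.IsConstituentOf (P.finRep.comp (inclPlace F E c N J v)) → Q c₀) :
    ∃ c₀ : IrrClass ↥(localPi E c N J v), c₀.IsConstituentOf (P.finRep.comp (inclPlace F E c N J v)) ∧ Q c₀ :=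
  (exists_isConstituentOf_finRep_comp P hirr hsm hP v).imp fun c₀ hc₀ => ⟨hc₀, hQ c₀ hc₀⟩

/-- **NON-VACUITY (D6 (b2) currency)**: if every class `c` of `U(J)(F_v)` whose pull-back along `localPiEquiv v` is a constituent of
`P.finRep ∘ inclPlace v` satisfies `Q` (e.g. `Q c := c ∈ (Πv v).members`), then some class satisfies `Q` — membership in the local
packet family is never vacuous for a `P` with a finite component. -/
theorem exists_comap_isConstituentOf_finRep_comp_and (P : DiscreteAutomorphicRep (adelicGroupData F E c N J) μ)
    {W : Type} [AddCommGroup W] [Module ℂ W] {σ : Representation ℂ (finAdelic F E c N J) W} (hirr : σ.IsIrreducible)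
    (hsm : σ.IsSmooth) (hP : P.HasFinComponent σ) (v : HeightOneSpectrum (𝓞 F)) {Q : IrrClass ↥(«local» E c N J v) → Prop}
    (hQ : ∀ c' : IrrClass ↥(«local» E c N J v),
      (IrrClass.comap (localPiEquiv E c N J v) c').IsConstituentOf (P.finRep.comp (inclPlace F E c N J v)) → Q c') :
    ∃ c' : IrrClass ↥(«local» E c N J v),
      (IrrClass.comap (localPiEquiv E c N J v) c').IsConstituentOf (P.finRep.comp (inclPlace F E c N J v)) ∧ Q c' :=
  (exists_comap_isConstituentOf_finRep_comp P hirr hsm hP v).imp fun c' hc' => ⟨hc', hQ c' hc'⟩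


/-! ## §3′ The SMOOTH-PART currency (b2′): constituents of `(P.finRep.smoothPart) ∘ inclPlace v` -/

/-- **An occurring smooth `σ` lands in the smooth part**: an injective `U(J)(𝔸_{F,f})`-map `σ → P.finRep` from a SMOOTH `σ`
corestricts to an injective `U(J)(𝔸_{F,f})`-map into ★ `P.finRep.smoothPart` (★ `IsSmoothVector.map`: intertwining maps preserve
smooth vectors). -/
theorem exists_intertwiningMap_smoothPart_of_hasFinComponent (P : DiscreteAutomorphicRep (adelicGroupData F E c N J) μ)
    {W : Type} [AddCommGroup W] [Module ℂ W] {σ : Representation ℂ (finAdelic F E c N J) W} (hsm : σ.IsSmooth)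
    (hP : P.HasFinComponent σ) :
    ∃ f : σ.IntertwiningMap P.finRep.smoothPart.toRepresentation, Function.Injective f := by
  obtain ⟨f, hf⟩ := hP
  have hmem : ∀ w : W, f.toLinearMap w ∈ P.finRep.smoothPart.toSubmodule := fun w => (hsm w).map f
  refine ⟨⟨LinearMap.codRestrict _ f.toLinearMap hmem, fun g => LinearMap.ext fun w => Subtype.ext ?_⟩, fun w w' h => ?_⟩
  · exact Representation.IntertwiningMap.isIntertwining _ _ f g w
  · exact hf (congrArg Subtype.val h)

/-- **(b2′) inheritance**: every constituent of `σ ∘ inclPlace v` is a constituent of `P.finRep.smoothPart ∘ inclPlace v`. -/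
theorem isConstituentOf_finRepSmooth_comp_of_hasFinComponent (P : DiscreteAutomorphicRep (adelicGroupData F E c N J) μ)
    {W : Type} [AddCommGroup W] [Module ℂ W] {σ : Representation ℂ (finAdelic F E c N J) W} (hsm : σ.IsSmooth)
    (hP : P.HasFinComponent σ) {v : HeightOneSpectrum (𝓞 F)} {c₀ : IrrClass ↥(localPi E c N J v)}
    (hc₀ : c₀.IsConstituentOf (σ.comp (inclPlace F E c N J v))) :
    c₀.IsConstituentOf (P.finRep.smoothPart.toRepresentation.comp (inclPlace F E c N J v)) := by
  obtain ⟨f, hf⟩ := exists_intertwiningMap_smoothPart_of_hasFinComponent P hsm hP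
  exact hc₀.of_injective_comp _ f hf

/-- **(b2′) existence**: `P.finRep.smoothPart ∘ inclPlace v` HAS a constituent at every finite place `v` as soon as `P` has an
irreducible smooth finite component. -/
theorem exists_isConstituentOf_finRepSmooth_comp (P : DiscreteAutomorphicRep (adelicGroupData F E c N J) μ)
    {W : Type} [AddCommGroup W] [Module ℂ W] {σ : Representation ℂ (finAdelic F E c N J) W} (hirr : σ.IsIrreducible)
    (hsm : σ.IsSmooth) (hP : P.HasFinComponent σ) (v : HeightOneSpectrum (𝓞 F)) :
    ∃ c₀ : IrrClass ↥(localPi E c N J v),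
      c₀.IsConstituentOf (P.finRep.smoothPart.toRepresentation.comp (inclPlace F E c N J v)) := by
  obtain ⟨c₀, hc₀⟩ := exists_isConstituentOf_comp_inclPlace hirr hsm v
  exact ⟨c₀, isConstituentOf_finRepSmooth_comp_of_hasFinComponent P hsm hP hc₀⟩

/-- **(b2′) existence, `comap` currency.** -/
theorem exists_comap_isConstituentOf_finRepSmooth_comp (P : DiscreteAutomorphicRep (adelicGroupData F E c N J) μ)
    {W : Type} [AddCommGroup W] [Module ℂ W] {σ : Representation ℂ (finAdelic F E c N J) W} (hirr : σ.IsIrreducible)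
    (hsm : σ.IsSmooth) (hP : P.HasFinComponent σ) (v : HeightOneSpectrum (𝓞 F)) :
    ∃ c' : IrrClass ↥(«local» E c N J v), (IrrClass.comap (localPiEquiv E c N J v) c').IsConstituentOf
      (P.finRep.smoothPart.toRepresentation.comp (inclPlace F E c N J v)) := by
  obtain ⟨c₀, hc₀⟩ := exists_isConstituentOf_finRepSmooth_comp P hirr hsm hP v
  exact ⟨IrrClass.comap (localPiEquiv E c N J v).symm c₀, by rwa [IrrClass.comap_comap_symm]⟩

end Generic

/-! ## §4 The CM frame `(L⁺, L, c̄, 3, H)`: classes of `(cmDatum L 3 H).Local v`, the carrier of `CMLocalAPacket L H v` -/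

section CM

variable {L : Type} [Field L] [NumberField L] [IsCMField L] {H : Matrix (Fin 3) (Fin 3) L}
  {μ : Measure (adelicGroupData (↥(maximalRealSubfield L)) L (IsCMField.complexConj L) 3 H).automorphicQuotient}
  [SMulInvariantMeasure (adelicGroupData (↥(maximalRealSubfield L)) L (IsCMField.complexConj L) 3 H).Adelic
    (adelicGroupData (↥(maximalRealSubfield L)) L (IsCMField.complexConj L) 3 H).automorphicQuotient μ]

/-- **CM frame, D6 (b2) currency verbatim**: for a discrete automorphic `P` of `U(H)`, `H ∈ M₃(L)`, with an irreducible smooth finite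
component `σ`, at every finite place `v` of `L⁺` there is a class `c : IrrClass ((cmDatum L 3 H).Local v)` (the member type of ★
`Rogawski1990.CMLocalAPacket L H v`) whose pull-back along ★ `localPiEquiv L c̄ 3 H v` is a constituent of `P.finRep ∘ inclPlace v`. -/
theorem exists_comap_isConstituentOf_finRep_comp_cm
    (P : DiscreteAutomorphicRep (adelicGroupData (↥(maximalRealSubfield L)) L (IsCMField.complexConj L) 3 H) μ)
    {W : Type} [AddCommGroup W] [Module ℂ W]
    {σ : Representation ℂ (finAdelic (↥(maximalRealSubfield L)) L (IsCMField.complexConj L) 3 H) W}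
    (hirr : σ.IsIrreducible) (hsm : σ.IsSmooth) (hP : P.HasFinComponent σ)
    (v : HeightOneSpectrum (𝓞 ↥(maximalRealSubfield L))) :
    ∃ c' : IrrClass ((cmDatum L 3 H).Local v),
      (IrrClass.comap (localPiEquiv L (IsCMField.complexConj L) 3 H v) c').IsConstituentOf
        (P.finRep.comp (inclPlace (↥(maximalRealSubfield L)) L (IsCMField.complexConj L) 3 H v)) :=
  exists_comap_isConstituentOf_finRep_comp P hirr hsm hP v

/-- **CM frame, non-vacuity**: with `Q c := c ∈ (Πv v).members` this is «`LocalConstituentsIn Πv` is never vacuously true at `v`». -/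
theorem exists_comap_isConstituentOf_finRep_comp_and_cm
    (P : DiscreteAutomorphicRep (adelicGroupData (↥(maximalRealSubfield L)) L (IsCMField.complexConj L) 3 H) μ)
    {W : Type} [AddCommGroup W] [Module ℂ W]
    {σ : Representation ℂ (finAdelic (↥(maximalRealSubfield L)) L (IsCMField.complexConj L) 3 H) W}
    (hirr : σ.IsIrreducible) (hsm : σ.IsSmooth) (hP : P.HasFinComponent σ)
    (v : HeightOneSpectrum (𝓞 ↥(maximalRealSubfield L))) {Q : IrrClass ((cmDatum L 3 H).Local v) → Prop}
    (hQ : ∀ c' : IrrClass ((cmDatum L 3 H).Local v),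
      (IrrClass.comap (localPiEquiv L (IsCMField.complexConj L) 3 H v) c').IsConstituentOf
        (P.finRep.comp (inclPlace (↥(maximalRealSubfield L)) L (IsCMField.complexConj L) 3 H v)) → Q c') :
    ∃ c' : IrrClass ((cmDatum L 3 H).Local v),
      (IrrClass.comap (localPiEquiv L (IsCMField.complexConj L) 3 H v) c').IsConstituentOf
        (P.finRep.comp (inclPlace (↥(maximalRealSubfield L)) L (IsCMField.complexConj L) 3 H v)) ∧ Q c' :=
  (exists_comap_isConstituentOf_finRep_comp_cm P hirr hsm hP v).imp fun c' hc' => ⟨hc', hQ c' hc'⟩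


/-- **CM frame, (b2′) smooth-part currency**: a class `c : IrrClass ((cmDatum L 3 H).Local v)` whose pull-back along `localPiEquiv … v`
is a constituent of `P.finRep.smoothPart ∘ inclPlace v` EXISTS (for `P` with an irreducible smooth finite component). -/
theorem exists_comap_isConstituentOf_finRepSmooth_comp_cm
    (P : DiscreteAutomorphicRep (adelicGroupData (↥(maximalRealSubfield L)) L (IsCMField.complexConj L) 3 H) μ)
    {W : Type} [AddCommGroup W] [Module ℂ W]
    {σ : Representation ℂ (finAdelic (↥(maximalRealSubfield L)) L (IsCMField.complexConj L) 3 H) W}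
    (hirr : σ.IsIrreducible) (hsm : σ.IsSmooth) (hP : P.HasFinComponent σ)
    (v : HeightOneSpectrum (𝓞 ↥(maximalRealSubfield L))) :
    ∃ c' : IrrClass ((cmDatum L 3 H).Local v),
      (IrrClass.comap (localPiEquiv L (IsCMField.complexConj L) 3 H v) c').IsConstituentOf
        (P.finRep.smoothPart.toRepresentation.comp (inclPlace (↥(maximalRealSubfield L)) L (IsCMField.complexConj L) 3 H v)) :=
  exists_comap_isConstituentOf_finRepSmooth_comp P hirr hsm hP v

/-- **CM frame, (b2′) non-vacuity**: with `Q c := c ∈ (Πv v).members` this is «(b2′) `LocalConstituentsIn Πv` is never vacuously true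
at `v`». -/
theorem exists_comap_isConstituentOf_finRepSmooth_comp_and_cm
    (P : DiscreteAutomorphicRep (adelicGroupData (↥(maximalRealSubfield L)) L (IsCMField.complexConj L) 3 H) μ)
    {W : Type} [AddCommGroup W] [Module ℂ W]
    {σ : Representation ℂ (finAdelic (↥(maximalRealSubfield L)) L (IsCMField.complexConj L) 3 H) W}
    (hirr : σ.IsIrreducible) (hsm : σ.IsSmooth) (hP : P.HasFinComponent σ)
    (v : HeightOneSpectrum (𝓞 ↥(maximalRealSubfield L))) {Q : IrrClass ((cmDatum L 3 H).Local v) → Prop}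
    (hQ : ∀ c' : IrrClass ((cmDatum L 3 H).Local v),
      (IrrClass.comap (localPiEquiv L (IsCMField.complexConj L) 3 H v) c').IsConstituentOf
        (P.finRep.smoothPart.toRepresentation.comp
          (inclPlace (↥(maximalRealSubfield L)) L (IsCMField.complexConj L) 3 H v)) → Q c') :
    ∃ c' : IrrClass ((cmDatum L 3 H).Local v),
      (IrrClass.comap (localPiEquiv L (IsCMField.complexConj L) 3 H v) c').IsConstituentOf
        (P.finRep.smoothPart.toRepresentation.comp
          (inclPlace (↥(maximalRealSubfield L)) L (IsCMField.complexConj L) 3 H v)) ∧ Q c' :=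
  (exists_comap_isConstituentOf_finRepSmooth_comp_cm P hirr hsm hP v).imp fun c' hc' => ⟨hc', hQ c' hc'⟩

end CM

end Summit.HodgeConjecture.HodgeConjecture.Cruxes.H413.F0P3FinRepConstituentsExist

end
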